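import Literature.NumberTheory.LFunctions.RayClassDHSlotData
import Literature.NumberTheory.LFunctions.RayClassLogFreeSieveSide
import HarnessLib

/-!
# The Deuring–Heilbronn phenomenon for the Hecke `L`-functions of a congruence class group `mod 𝔪`

Topic `Literature/NumberTheory/LFunctions` (namespace `Literature.NumberTheory.LFunctions.AbelianDensity`, next to
`RayClassLFunctionExceptionalZero.lean`).  Everything here is PROVED (theorems only; no named facts).

This is the ray-class counterpart of the tree's `DeuringHeilbronn.deuringHeilbronn` (class group characters,
conductor `1`), i.e. Thorner–Zaman's Theorem 1.3 (b) / §7.2 and Lagarias–Montgomery–Odlyzko's Theorem 5.1 for the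
family of Hecke `L`-functions attached to the characters `ψ` of a congruence class group `H ⊇ P^𝔪` of the number
field `K` (an abelian Frobenius datum `f : 𝔭 ↦ f 𝔭 ∈ G` killing the narrow ray `mod 𝔪 ≠ 0` whose non-trivial characters
are non-principal off `𝔪`; "`ρ` is a zero of the factor `ψ`" means `L_ψ(ρ) = 0` for the entire Hecke `L`-function of
the primitive associate of `ψ ∘ f` (`datumData`) if `ψ ≠ 0`, and `ζ₁_K(ρ) = 0` if `ψ = 0`).

**Theorem** (`deuringHeilbronn_congruence`).  There is an absolute, effectively computable `C > 0` such that for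
every such datum, every real character `ψ₁` (`ψ₁ + ψ₁ = 0`) whose factor has a real zero `β₁ ∈ (0, 1)`, every
character `ψ` and every zero `ρ ≠ 1, β₁` of the factor `ψ` with `Re ρ ≥ 1/2`,

  `log(1/(C ℒ (1 − β₁)))/(C ℒ) ≤ 1 − Re ρ`,  `ℒ = log(|d_K| N𝔪) + n_K (log(|Im ρ| + 2) + 1)`.

[ThornerZaman2017, Theorem 1.3 and §7.2 (with `L = ` the class field of `H`, `D_K 𝒬 ≤ (|d_K| N𝔪)^{O(1)}`)]
[LagariasMontgomeryOdlyzko1979, Theorem 5.1].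

Proof.  The abstract four-slot power-sum argument `DHSlot.dh_of_slots` (`DeuringHeilbronnSlots.lean`) fed with the
slots of `RayClassDHSlotData.lean`: `ζ_K`, `L(·, ψ₁)` at `2` and `L(·, ψ)`, `L(·, ψ₁ψ)` at `2 + iγ`, all taken
IMPRIMITIVE `mod 𝔪` (Euler factors at `𝔭 ∣ 𝔪` adjoined as nodes on `Re = 0`, [ThornerZaman2017, Lemma 7.3]) so that
the Dirichlet side `Σ_{(𝔫,𝔪)=1} Λ(𝔫)(1 + ψ₁(𝔫))(1 + Re ψ(𝔫)N𝔫^{−iγ}) (log N𝔫)^{2μ−1} N𝔫^{−2}` is non-negative termwise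
(`re_rayPairLSeries_sum_nonneg`); the `M`-bounds of the slots are `≪ ℒ` by the digamma bounds
`DH.exists_re_pole_gamma_le`, `exists_re_pole_cond_gamma_le`, `N𝔣_ψ ≤ N𝔪` and `Σ_{𝔭∣𝔪} log N𝔭 ≤ log N𝔪`.

## References
* [ThornerZaman2017] J. Thorner, A. Zaman, *An explicit bound for the least prime ideal in the Chebotarev density
  theorem*, Algebra Number Theory 11 (2017), Theorem 1.3, §7.2.
* [LagariasMontgomeryOdlyzko1979] J. C. Lagarias, H. L. Montgomery, A. M. Odlyzko, *A bound for the least prime ideal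
  in the Chebotarev density theorem*, Invent. Math. 54 (1979), Theorem 5.1.
* [Weiss1983] A. Weiss, *The least prime ideal*, J. reine angew. Math. 338 (1983), Theorem 1.6.
-/

noncomputable section

open scoped NumberField
open Complex Filter Topology Set NumberField NumberField.InfinitePlace IsDedekindDomain Classical

namespace Literature.NumberTheory.LFunctions.AbelianDensity

open Literature.NumberTheory.LFunctions.NumberField Literature.NumberTheory.LFunctions.NumberField.DH
  Literature.Analysis.Complex Literature.NumberTheory.LFunctions.LogFreeLocal

variable {K : Type} [Field K] [NumberField K] {G : Type} [CommGroup G] [Finite G]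
variable {𝔪 : Ideal (𝓞 K)} {f : HeightOneSpectrum (𝓞 K) → G}

omit [NumberField K] [Finite G] in
/-- `χ ↦ χ ∘ f` at the trivial character is `1`. [folklore] -/
private theorem charFun_zero_eq : charFun f (0 : AddChar (Additive G) ℂ) = fun _ ↦ (1 : ℂ) :=
  funext fun _ ↦ rfl

omit [NumberField K] [Finite G] in
/-- `(ψ₁ + ψ₂) ∘ f = (ψ₁ ∘ f)(ψ₂ ∘ f)` pointwise. [folklore] -/
private theorem charFun_add_apply (ψ₁ ψ₂ : AddChar (Additive G) ℂ) (v : HeightOneSpectrum (𝓞 K)) :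
    charFun f (ψ₁ + ψ₂) v = charFun f ψ₁ v * charFun f ψ₂ v := rfl

omit [NumberField K] [Finite G] in
/-- A real character takes the values `±1`: `(ψ₁ ∘ f)(𝔭)² = 1`. [folklore] -/
private theorem charFun_sq_eq_one {ψ₁ : AddChar (Additive G) ℂ} (h₁ : ψ₁ + ψ₁ = 0) (v : HeightOneSpectrum (𝓞 K)) :
    charFun f ψ₁ v ^ 2 = 1 := by
  rw [sq, ← charFun_add_apply, h₁]; rfl

/-- A zero `ρ ≠ 1` of `ζ₁_K` is a zero of `L(·, 1) = ζ_K`. [folklore] -/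
private theorem classGroupLFunction_one_eq_zero {ρ : ℂ} (hρ1 : ρ ≠ 1) (h : dedekindZeta₁ K ρ = 0) :
    classGroupLFunction K 1 ρ = 0 := by
  rw [dedekindZeta₁_apply_of_ne_one hρ1, mul_eq_zero, sub_eq_zero] at h
  rw [classGroupLFunction_one K hρ1]
  exact h.resolve_left hρ1

/-- A zero `ρ ≠ 1`, `Re ρ > 0`, of the factor `ψ` has `Re ρ ≤ 1`. [folklore] -/
private theorem re_le_one_of_zero (h𝔪 : 𝔪 ≠ ⊥) (hray : ArtinKillsRay 𝔪 f)
    (hsep : ∀ χ : AddChar (Additive G) ℂ, χ ≠ 0 →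
      ∃ v : HeightOneSpectrum (𝓞 K), ¬ 𝔪 ≤ v.asIdeal ∧ χ (Additive.ofMul (f v)) ≠ 1)
    {ψ : AddChar (Additive G) ℂ} {ρ : ℂ} (hρ0 : 0 < ρ.re) (hρ1 : ρ ≠ 1)
    (hz : (ψ = 0 → dedekindZeta₁ K ρ = 0) ∧ (∀ hψ : ψ ≠ 0, (datumData h𝔪 hray hsep ψ hψ).L ρ = 0)) :
    ρ.re ≤ 1 := by
  by_cases hψ : ψ = 0
  · have hL1 := classGroupLFunction_one_eq_zero hρ1 (hz.1 hψ)
    have hΞ : classXiPair K 1 ρ = 0 := by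
      rw [classXiPair, classXi_eq_zero_of_classGroupLFunction_eq_zero 1 hρ0 hρ1 hL1, zero_mul]
    exact re_le_one_of_classXiPair_eq_zero 1 hΞ
  · set D := datumData h𝔪 hray hsep ψ hψ with hD
    have hnt : ∃ v : HeightOneSpectrum (𝓞 K), ¬ 𝔪 ≤ v.asIdeal ∧ charFun f ψ v ≠ 1 := hsep ψ hψ
    have hL : D.L ρ = 0 := hz.2 hψ
    exact (D.xiData hnt).re_le_one_of_xiPair_eq_zero
      ((D.xiData hnt).xiPair_eq_zero_of_L_eq_zero hρ0 (by simpa using hL))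

/-- **The slot of the factor `ψ`** at `2 + it` with exceptional point `β₁ ∈ (1/2, 1)` and removal flag `w`
(`w →` the factor vanishes at `β₁`): pole coefficient `2·[ψ = 0]`, removed multiplicity `2·[w]`, Dirichlet sides
`P_{2μ−1}(ψ ∘ f mod 𝔪, 2 + it)`, `M`-bound `≪ log(|d_K|N𝔪) + n_K(1 + log(|t|+2))`, and every zero `ρ ∉ {1, β₁}`,
`Re ρ > 0`, of the factor is a node of positive weight. [folklore] -/
private theorem exists_slot (h𝔪 : 𝔪 ≠ ⊥) (hray : ArtinKillsRay 𝔪 f)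
    (hsep : ∀ χ : AddChar (Additive G) ℂ, χ ≠ 0 →
      ∃ v : HeightOneSpectrum (𝓞 K), ¬ 𝔪 ≤ v.asIdeal ∧ χ (Additive.ofMul (f v)) ≠ 1)
    {A₀ A₁ : ℝ} (hA₀ : 0 ≤ A₀) (hA₁ : 0 ≤ A₁)
    (hgam₀ : ∀ t : ℝ, ((2 : ℂ) / (2 + t * I) + 2 / (2 + t * I - 1) +
        2 * logDeriv (dedekindGammaFactor K) (2 + t * I)).re ≤
      3 + Real.log ((discr K).natAbs : ℝ) + Module.finrank ℚ K * (A₀ + 2 * Real.log (|t| + 2)))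
    (hgam₁ : ∀ (p : Finset {w : InfinitePlace K // IsReal w}) (A : ℝ), 1 ≤ A → ∀ t : ℝ,
      ((2 : ℂ) / (2 + t * I) + 2 / (2 + t * I - 1) + (Real.log A : ℂ) +
          2 * logDeriv (rayClassGammaFactor K p) (2 + t * I)).re ≤
        3 + Real.log A + Module.finrank ℚ K * (A₁ + 2 * Real.log (|t| + 2)))
    (ψ : AddChar (Additive G) ℂ) {β₁ : ℝ} (hβ0 : 0 < β₁) (hβhalf : 1 / 2 < β₁) (hβ1 : β₁ < 1) (w : Prop)
    (hw : w → (ψ = 0 → dedekindZeta₁ K β₁ = 0) ∧ (∀ hψ : ψ ≠ 0, (datumData h𝔪 hray hsep ψ hψ).L β₁ = 0))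
    (t : ℝ) :
    ∃ S : DHSlot.{0} (2 + t * I) β₁,
      S.a = 2 * (if ψ = 0 then 1 else 0) ∧ S.e = 2 * (if w then 1 else 0) ∧
      (∀ μ : ℕ, S.P μ = rayPairLSeries 𝔪 (charFun f ψ) (2 * μ - 1) (2 + t * I)) ∧
      S.B ≤ 3 + 7 * Real.log (((discr K).natAbs : ℝ) * ((Ideal.absNorm 𝔪 : ℕ) : ℝ)) +
          Module.finrank ℚ K * (A₀ + A₁ + 2 * Real.log (|t| + 2)) + 2 * Module.finrank ℚ K * zetaTwo -
          (rayPairLSeries 𝔪 (charFun f ψ) 0 (2 + t * I)).re ∧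
      ∀ ρ : ℂ, 0 < ρ.re → ρ ≠ 1 → ρ ≠ β₁ → (ψ = 0 → dedekindZeta₁ K ρ = 0) →
        (∀ hψ : ψ ≠ 0, (datumData h𝔪 hray hsep ψ hψ).L ρ = 0) → ∃ i : S.ι, 0 < S.w i ∧ S.ω i = ρ := by
  have hpre : ((2 : ℂ) + t * I).re = 2 := by simp
  have hp1 : 1 < ((2 : ℂ) + t * I).re := by rw [hpre]; norm_num
  have hinv : (((2 : ℂ) + t * I).re - 1)⁻¹ = 1 := by rw [hpre]; norm_num
  have hn0 : (0 : ℝ) ≤ Module.finrank ℚ K := Nat.cast_nonneg _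
  have hd1 : (1 : ℝ) ≤ ((discr K).natAbs : ℝ) := by exact_mod_cast Int.natAbs_pos.mpr (discr_ne_zero K)
  have hm1 : (1 : ℝ) ≤ ((Ideal.absNorm 𝔪 : ℕ) : ℝ) := by
    exact_mod_cast Nat.one_le_iff_ne_zero.mpr (by rwa [Ne, Ideal.absNorm_eq_zero_iff])
  have hdm : ((discr K).natAbs : ℝ) ≤ ((discr K).natAbs : ℝ) * ((Ideal.absNorm 𝔪 : ℕ) : ℝ) := by nlinarith
  have hmd : ((Ideal.absNorm 𝔪 : ℕ) : ℝ) ≤ ((discr K).natAbs : ℝ) * ((Ideal.absNorm 𝔪 : ℕ) : ℝ) := by nlinarith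
  have hLd_le : Real.log ((discr K).natAbs : ℝ) ≤ Real.log (((discr K).natAbs : ℝ) * ((Ideal.absNorm 𝔪 : ℕ) : ℝ)) :=
    Real.log_le_log (by linarith) hdm
  have hLm_le : Real.log ((Ideal.absNorm 𝔪 : ℕ) : ℝ) ≤ Real.log (((discr K).natAbs : ℝ) * ((Ideal.absNorm 𝔪 : ℕ) : ℝ)) :=
    Real.log_le_log (by linarith) hmd
  have hlog2 : Real.log 2 ≤ Real.log (|t| + 2) := Real.log_le_log two_pos (by linarith [abs_nonneg t])
  have hlog2' : (0 : ℝ) ≤ Real.log 2 := Real.log_nonneg (by norm_num)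
  have hβhalf' : (β₁ : ℂ) ≠ 1 / 2 := fun h ↦ by
    have := congrArg Complex.re h; simp at this; linarith
  have hβ0' : (β₁ : ℂ) ≠ 0 := by exact_mod_cast hβ0.ne'
  have hβ1' : (β₁ : ℂ) ≠ 1 := by exact_mod_cast hβ1.ne
  by_cases hψ : ψ = 0
  · -- the principal slot
    subst hψ
    obtain ⟨D₀⟩ := nonempty_symmHadamardData_classXiPair (K := K) 1
    have hw' : w → classXiPair K 1 β₁ = 0 ∧ deriv (classXiPair K 1) β₁ = 0 := fun h ↦
      classXiPair_double_of_real (mul_one_char 1) hβ0 hβ1.ne (classGroupLFunction_one_eq_zero hβ1' ((hw h).1 rfl))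
    obtain ⟨R₀⟩ := exists_removal D₀ hβhalf' hβ0' hβ1' w hw'
    refine ⟨principalDHSlot h𝔪 D₀ R₀ hp1, by simp, principalDHSlot_e h𝔪 D₀ R₀ hp1, fun μ ↦ ?_, ?_, ?_⟩
    · rw [charFun_zero_eq]; rfl
    · have hB := principalDHSlot_B_le h𝔪 D₀ R₀ hp1
      have hG := hgam₀ t
      have hE := sum_eulerBound_le_log_absNorm (primeDivisors K h𝔪) h𝔪 (fun v hv ↦ dvd_of_mem_primeDivisors h𝔪 hv)
      rw [hinv, one_mul, hpre] at hB
      rw [charFun_zero_eq]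
      linarith [mul_nonneg hn0 hA₁]
    · intro ρ hρ0 hρ1 hρβ hz _
      exact principalDHSlot_exists_idx h𝔪 D₀ R₀ hp1 hρ0 hρ1 hρβ (classGroupLFunction_one_eq_zero hρ1 (hz rfl))
  · -- the slot of a non-trivial character
    set D := datumData h𝔪 hray hsep ψ hψ with hD
    have hnt : ∃ v : HeightOneSpectrum (𝓞 K), ¬ 𝔪 ≤ v.asIdeal ∧ charFun f ψ v ≠ 1 := hsep ψ hψ
    obtain ⟨Dx⟩ := (D.xiData hnt).nonempty_symmHadamardData_xiPair
    have hw' : w → (D.xiData hnt).xiPair β₁ = 0 ∧ deriv (D.xiData hnt).xiPair β₁ = 0 := fun h ↦ by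
      have hL : D.L β₁ = 0 := (hw h).2 hψ
      exact (D.xiData hnt).xiPair_double_of_L (by simpa using hβ0) (by simpa using hL)
        (by simpa using D.Lconj_ofReal_eq_zero hL)
    obtain ⟨R⟩ := (D.xiData hnt).exists_coreRemoval Dx hβhalf' hβ0' hβ1' w hw'
    refine ⟨D.dhSlot hnt Dx R hp1, by simp [hψ], D.dhSlot_e hnt Dx R hp1, fun μ ↦ rfl, ?_, ?_⟩
    · have hB := D.dhSlot_B_le hnt Dx R hp1
      have hA1 : 1 ≤ rayCond K D.𝔣 := one_le_rayCond (K := K) D.ne_bot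
      have hG := hgam₁ D.p (rayCond K D.𝔣) hA1 t
      have hE := sum_eulerBound_le_log_absNorm D.badPrimes h𝔪 (fun v hv ↦ D.dvd_of_mem_badPrimes hv)
      have hcond : Real.log (rayCond K D.𝔣) ≤ Real.log (((discr K).natAbs : ℝ) * ((Ideal.absNorm 𝔪 : ℕ) : ℝ)) := by
        apply Real.log_le_log (by linarith)
        have hdisc : |(discr K : ℝ)| = ((discr K).natAbs : ℝ) := by rw [Nat.cast_natAbs, Int.cast_abs]
        rw [rayCond, hdisc]
        exact mul_le_mul_of_nonneg_left D.absNorm_le (by linarith)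
      rw [hinv, one_mul, hpre] at hB
      linarith [mul_nonneg hn0 hA₀]
    · intro ρ hρ0 hρ1 hρβ _ hz
      exact D.dhSlot_exists_idx hnt Dx R hp1 hρ0 hρ1 hρβ (hz hψ)

/-- **The Deuring–Heilbronn phenomenon for the Hecke `L`-functions of a congruence class group `mod 𝔪`**
(Thorner–Zaman's Theorem 1.3 (b) / §7.2, Lagarias–Montgomery–Odlyzko's Theorem 5.1): there is an absolute
constant `C > 0` such that for every number field `K`, every abelian Frobenius datum `f` killing the narrow ray
`mod 𝔪 ≠ 0` with non-trivial characters non-principal off `𝔪`, every real character `ψ₁` (`ψ₁ + ψ₁ = 0`) whose factor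
(`ζ₁_K` for `ψ₁ = 0`, `L_{ψ₁}` else) has the real zero `β₁ ∈ (0, 1)`, every character `ψ` and every zero `ρ` of
the factor `ψ` with `Re ρ ≥ 1/2`, `ρ ≠ 1`, `ρ ≠ β₁`:
`log(1/(C ℒ (1 − β₁)))/(C ℒ) ≤ 1 − Re ρ`, `ℒ = log(|d_K| N𝔪) + n_K (log(|Im ρ| + 2) + 1)`.
[cite: ThornerZaman2017, Theorem 1.3 and §7.2] [cite: LagariasMontgomeryOdlyzko1979, Theorem 5.1] -/
theorem deuringHeilbronn_congruence :
    ∃ C : ℝ, 0 < C ∧ ∀ (K : Type) [Field K] [NumberField K] (G : Type) [CommGroup G] [Finite G]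
      (𝔪 : Ideal (𝓞 K)) (f : HeightOneSpectrum (𝓞 K) → G) (h𝔪 : 𝔪 ≠ ⊥) (hray : ArtinKillsRay 𝔪 f)
      (hsep : ∀ χ : AddChar (Additive G) ℂ, χ ≠ 0 →
        ∃ v : HeightOneSpectrum (𝓞 K), ¬ 𝔪 ≤ v.asIdeal ∧ χ (Additive.ofMul (f v)) ≠ 1)
      (ψ₁ : AddChar (Additive G) ℂ), ψ₁ + ψ₁ = 0 →
      ∀ β₁ : ℝ, 0 < β₁ → β₁ < 1 →
      ((ψ₁ = 0 → dedekindZeta₁ K β₁ = 0) ∧ (∀ hψ₁ : ψ₁ ≠ 0, (datumData h𝔪 hray hsep ψ₁ hψ₁).L β₁ = 0)) →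
      ∀ (ψ : AddChar (Additive G) ℂ) (ρ : ℂ),
      ((ψ = 0 → dedekindZeta₁ K ρ = 0) ∧ (∀ hψ : ψ ≠ 0, (datumData h𝔪 hray hsep ψ hψ).L ρ = 0)) →
      1 / 2 ≤ ρ.re → ρ ≠ 1 → ρ ≠ β₁ →
        Real.log (1 / (C * (Real.log (((discr K).natAbs : ℝ) * ((Ideal.absNorm 𝔪 : ℕ) : ℝ)) +
            Module.finrank ℚ K * (Real.log (|ρ.im| + 2) + 1)) * (1 - β₁))) /
          (C * (Real.log (((discr K).natAbs : ℝ) * ((Ideal.absNorm 𝔪 : ℕ) : ℝ)) +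
            Module.finrank ℚ K * (Real.log (|ρ.im| + 2) + 1))) ≤ 1 - ρ.re := by
  obtain ⟨A₀, hA₀, hgam₀⟩ := exists_re_pole_gamma_le
  obtain ⟨A₁, hA₁, hgam₁⟩ := exists_re_pole_cond_gamma_le
  have hZ₂ := zetaTwo_nonneg
  have hA : 0 ≤ A₀ + A₁ := add_nonneg hA₀ hA₁
  -- constants
  set C₁ : ℝ := 48 + 4 * (A₀ + A₁) + 8 * zetaTwo with hC₁
  have hC₁1 : 1 ≤ C₁ := by rw [hC₁]; linarith
  refine ⟨49608 * C₁, by positivity, ?_⟩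
  intro K _ _ G _ _ 𝔪 f h𝔪 hray hsep ψ₁ h₁ β₁ hβ0 hβ1 hz₁ ψ ρ hzρ hρre hρ1 hρβ
  -- notation
  set n : ℝ := (Module.finrank ℚ K : ℝ) with hn
  set LQ : ℝ := Real.log (((discr K).natAbs : ℝ) * ((Ideal.absNorm 𝔪 : ℕ) : ℝ)) with hLQ
  set t : ℝ := ρ.im with ht
  set ℒ : ℝ := LQ + n * (Real.log (|t| + 2) + 1) with hℒ
  set δ₁ : ℝ := 1 - β₁ with hδ₁
  set C : ℝ := 49608 * C₁ with hC
  have hδ₁0 : 0 < δ₁ := by rw [hδ₁]; linarith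
  have hn1 : 1 ≤ n := by rw [hn]; exact_mod_cast Module.finrank_pos
  have hn0 : 0 ≤ n := by linarith
  have hLQ0 : 0 ≤ LQ := Real.log_nonneg (one_le_discr_mul_absNorm K h𝔪)
  have hlog2 : 0 ≤ Real.log (|t| + 2) := Real.log_nonneg (by linarith [abs_nonneg t])
  have hlog22 : Real.log (|(0 : ℝ)| + 2) ≤ Real.log (|t| + 2) := by
    rw [abs_zero, zero_add]; exact Real.log_le_log two_pos (by linarith [abs_nonneg t])
  have hℒ1 : 1 ≤ ℒ := by rw [hℒ]; nlinarith
  have hℒ0 : 0 < ℒ := by linarith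
  have hC0 : 0 < C := by positivity
  -- `Re ρ ≤ 1`, so `x = 1 − Re ρ ≥ 0`
  have hρ0 : 0 < ρ.re := by linarith
  have hρle : ρ.re ≤ 1 := re_le_one_of_zero h𝔪 hray hsep hρ0 hρ1 hzρ
  set x : ℝ := 1 - ρ.re with hx
  have hx0 : 0 ≤ x := by rw [hx]; linarith
  have hx12 : x ≤ 1 / 2 := by rw [hx]; linarith
  -- the trivial case: a negative bound
  have htriv : Real.log (1 / (C * ℒ * δ₁)) < 0 → Real.log (1 / (C * ℒ * δ₁)) / (C * ℒ) ≤ x := fun hneg ↦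
    (div_nonpos_of_nonpos_of_nonneg hneg.le (by positivity)).trans hx0
  by_cases hβhalf : β₁ ≤ 1 / 2
  · apply htriv
    rw [one_div, Real.log_inv, neg_lt_zero]
    apply Real.log_pos
    have h49 : (49608 : ℝ) ≤ C := by rw [hC]; linarith
    have hδ : 1 / 2 ≤ δ₁ := by rw [hδ₁]; linarith
    have h1 : (49608 : ℝ) * 1 ≤ C * ℒ := mul_le_mul h49 hℒ1 (by norm_num) hC0.le
    nlinarith [mul_nonneg (sub_nonneg.mpr h1) (sub_nonneg.mpr hδ)]
  push Not at hβhalf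
  -- the zero hypothesis, transported along equalities of characters
  have hzgen : ∀ χ : AddChar (Additive G) ℂ, χ = ψ₁ →
      (χ = 0 → dedekindZeta₁ K β₁ = 0) ∧ (∀ hχ : χ ≠ 0, (datumData h𝔪 hray hsep χ hχ).L β₁ = 0) := by
    rintro χ rfl; exact hz₁
  have hψψ₁ : ψ₁ + ψ = 0 → ψ = ψ₁ := fun h ↦
    neg_injective (((add_eq_zero_iff_eq_neg.mp h).symm).trans (add_eq_zero_iff_eq_neg.mp h₁))
  -- the four slots
  obtain ⟨S₀, ha₀, he₀, hP₀, hB₀, -⟩ := exists_slot h𝔪 hray hsep hA₀ hA₁ (hgam₀ K) (hgam₁ K) 0 hβ0 hβhalf hβ1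
    (ψ₁ = 0) (fun h ↦ hzgen 0 h.symm) 0
  obtain ⟨S₁, ha₁, he₁, hP₁, hB₁, -⟩ := exists_slot h𝔪 hray hsep hA₀ hA₁ (hgam₀ K) (hgam₁ K) ψ₁ hβ0 hβhalf hβ1
    True (fun _ ↦ hz₁) 0
  obtain ⟨S₂, ha₂, he₂, hP₂, hB₂, hidx₂⟩ := exists_slot h𝔪 hray hsep hA₀ hA₁ (hgam₀ K) (hgam₁ K) ψ hβ0 hβhalf
    hβ1 (ψ₁ + ψ = 0) (fun h ↦ hzgen ψ (hψψ₁ h)) t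
  obtain ⟨S₃, ha₃, he₃, hP₃, hB₃, -⟩ := exists_slot h𝔪 hray hsep hA₀ hA₁ (hgam₀ K) (hgam₁ K) (ψ₁ + ψ) hβ0
    hβhalf hβ1 (ψ = 0) (fun h ↦ hzgen (ψ₁ + ψ) (by rw [h, add_zero])) t
  -- balance
  have hbal₁ : S₀.a + S₁.a = S₀.e + S₁.e := by
    rw [ha₀, ha₁, he₀, he₁]; simp only [if_true]; split_ifs <;> ring
  have hbal₂ : S₂.a + S₃.a = S₂.e + S₃.e := by rw [ha₂, ha₃, he₂, he₃]; ring
  -- the Dirichlet sides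
  have hψ₁sq : ∀ v : HeightOneSpectrum (𝓞 K), ¬ 𝔪 ≤ v.asIdeal → charFun f ψ₁ v ^ 2 = 1 :=
    fun v _ ↦ charFun_sq_eq_one h₁ v
  have hmul : charFun f (ψ₁ + ψ) = fun v ↦ charFun f ψ₁ v * charFun f ψ v := funext (charFun_add_apply ψ₁ ψ)
  have e0 : (2 : ℂ) + ((0 : ℝ) : ℂ) * I = ((2 : ℝ) : ℂ) := by push_cast; ring
  have e1 : (2 : ℂ) + (t : ℂ) * I = ((2 : ℝ) : ℂ) + t * I := by push_cast; ring
  have hpos : ∀ μ : ℕ, 1 ≤ μ → 0 ≤ (S₀.P μ + S₁.P μ + S₂.P μ + S₃.P μ).re := by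
    intro μ _
    rw [hP₀, hP₁, hP₂, hP₃, charFun_zero_eq, hmul, e0, e1]
    exact re_rayPairLSeries_sum_nonneg h𝔪 hψ₁sq (norm_charFun_le 𝔪 f ψ) (by norm_num) t _
  have hPre0 : 0 ≤ (rayPairLSeries 𝔪 (charFun f 0) 0 (2 + ((0 : ℝ) : ℂ) * I)).re +
      (rayPairLSeries 𝔪 (charFun f ψ₁) 0 (2 + ((0 : ℝ) : ℂ) * I)).re +
      (rayPairLSeries 𝔪 (charFun f ψ) 0 (2 + (t : ℂ) * I)).re +
      (rayPairLSeries 𝔪 (charFun f (ψ₁ + ψ)) 0 (2 + (t : ℂ) * I)).re := by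
    have h := re_rayPairLSeries_sum_nonneg h𝔪 hψ₁sq (norm_charFun_le 𝔪 f ψ) (σ := 2) (by norm_num) t 0
    rw [charFun_zero_eq, hmul, e0, e1]
    simpa only [add_re] using h
  -- the `M`-bound
  have hBtot : S₀.B + S₁.B + S₂.B + S₃.B ≤ C₁ * ℒ := by
    have hfin : 12 + 28 * LQ + 4 * n * (A₀ + A₁) + 8 * n * Real.log (|t| + 2) + 8 * n * zetaTwo ≤ C₁ * ℒ := by
      have hexp : C₁ * ℒ = 48 * LQ + 48 * (n * Real.log (|t| + 2)) + 48 * n + 4 * ((A₀ + A₁) * LQ) +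
          4 * ((A₀ + A₁) * (n * Real.log (|t| + 2))) + 4 * ((A₀ + A₁) * n) + 8 * (zetaTwo * LQ) +
          8 * (zetaTwo * (n * Real.log (|t| + 2))) + 8 * (zetaTwo * n) := by
        rw [hC₁, hℒ]; ring
      rw [hexp]
      linarith [mul_nonneg hA hLQ0, mul_nonneg hA (mul_nonneg hn0 hlog2), mul_nonneg hZ₂ hLQ0,
        mul_nonneg hZ₂ (mul_nonneg hn0 hlog2), mul_nonneg hn0 hlog2]
    have w0 := mul_le_mul_of_nonneg_left hlog22 hn0
    rw [← hn, ← hLQ] at hB₀ hB₁ hB₂ hB₃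
    linarith [hB₀, hB₁, hB₂, hB₃, hPre0, w0, hfin]
  -- the node of `ρ`
  obtain ⟨i₂, hi₂, hωi₂⟩ := hidx₂ ρ hρ0 hρ1 hρβ hzρ.1 hzρ.2
  have hω : (2 + (t : ℂ) * I) - S₂.ω i₂ = ((1 + x : ℝ) : ℂ) := by
    rw [hωi₂]
    apply Complex.ext
    · simp [hx]; ring
    · simp [ht]
  -- the abstract argument
  have hB1 : 1 ≤ C₁ * ℒ := one_le_mul_of_one_le_of_one_le hC₁1 hℒ1
  have key := DHSlot.dh_of_slots hβhalf hβ1 (pσ := 2 + ((0 : ℝ) : ℂ) * I) (ps := 2 + (t : ℂ) * I) (by simp)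
    (by simp) S₀ S₁ S₂ S₃ hbal₁ hbal₂ hpos hB1 hBtot hx0 hx12 i₂ hi₂ hω
  have e : 49608 * (C₁ * ℒ) = C * ℒ := by rw [hC]; ring
  rw [e] at key
  exact key

end Literature.NumberTheory.LFunctions.AbelianDensity

end
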